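import Literature.RepresentationTheory.GeneralLinear.AlternatingWordCoefficients
import HarnessLib

/-!
# Position-dependent operators on the word model: the tensor product `ρ₁ ⊗ ⋯ ⊗ ρ_d` of DIFFERENT
# matrix actions on `(k^N)^{⊗d}`, its differential, and the adjoint equivariance

Topic `Literature/RepresentationTheory/GeneralLinear`; infrastructure over the coordinate ("words")
model of tensor powers (`TensorWordModel.wordRep`: `GL_N` acts on functions on words `Fin d → Fin N`
by Kronecker powers; `WordRaisingOperator.wordDer`: its differential `D(A) = ∑_p 1 ⊗ ⋯ ⊗ A ⊗ ⋯ ⊗ 1`;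
`AlternatingWordCoefficients`: slices `wordSlice`, the colour base change `colourChange`, the adjoint
equivariance `wordRep_wordDer_of_mul_eq`). Those files move EVERY tensor position by the SAME matrix —
enough for powers `Eⁿ` of ONE elliptic curve, where all the letters `g_i^* e_ℓ` of
`H¹(Eⁿ) = ⊕ g_i^* H¹(E)` undergo the same change of basis and the same Hodge operator. For a product
`E₁^{n₁} × ⋯ × E_r^{n_r}` of SEVERAL curves the letter at position `p` of a cup monomial belongs to the
curve of its slot, and the change of basis / the Hodge operator / the Lie algebra `⊕_k 𝔤𝔩₂` act at
position `p` through a matrix depending on `p`. This file supplies that position-dependent calculus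
(Goodman–Wallach §4.1.1: the tensor product `ρ₁ ⊗ ⋯ ⊗ ρ_d` of representations and its differential
`X ↦ ∑_p 1 ⊗ ⋯ ⊗ dρ_p(X) ⊗ ⋯ ⊗ 1`; Fulton §8.1: the word basis), written for the cell
`pub-hodge-ring2` (literature seat, gen 33) as brick L2a between the Lie step
`Sl2ProductRationalSubalgebras.sl2_product_annihilator` (whose output is "`𝔰𝔩₂` placed in the slots
of colour `i` kills the rational coefficient tensor") and the geometric assembly of Imai's theorem.
PUBLISHED STATEMENTS (elementary multilinear algebra), NEW FORMAL PROOFS (mirroring the one-matrix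
proofs of the files above, position by position).

## Contents (all proved; no named fact, no `sorry`)

* §1 `tensorMatrixAt g` — the Kronecker product `g₀ ⊗ ⋯ ⊗ g_{d-1}` of a FAMILY of matrices
  `g : Fin d → M_N(k)`, `(w', w) ↦ ∏_p (g p)_{w' p, w p}`; multiplicative and unital in the family
  (pointwise product), and equal to the tree's Kronecker power `tensorPowerMatrix` on constant families.
* §2 `wordRepAt g` — the action `(g · c)(w') = ∑_w (∏_p (g p)_{w' p, w p}) c(w)` on the word model;
  `wordRepAt_mul`, `wordRepAt_one`, `wordRepAt_const` (`= wordRep` on constant invertible families),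
  injectivity for pointwise-invertible families.
* §3 `wordDerAt A` — the differential `(D(A) c)(w) = ∑_p ∑_b (A p)_{w p, b} c(w[p ↦ b])` for a family
  `A : Fin d → 𝔤𝔩_N(k)`; linear in `A`, `wordDerAt_const` (`= wordDer`), base change `wordDerAt_map`,
  the value on a family supported at one position, on diagonal families, and the Lie property
  **`wordDerAt_commutator`: `[D(A), D(B)] = D(p ↦ [A p, B p])`** (the differential of a tensor
  product of representations is a representation of the product Lie algebra), so annihilators are
  closed under pointwise commutators (`wordDerAt_commutator_eq_zero`; the input `hlie` of
  `sl2_product_annihilator`).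
* §4 **adjoint equivariance** `wordRepAt_wordDerAt_of_mul_eq`: `g · D(A) c = D(B) (g · c)` whenever
  `B p · g p = g p · A p` for all `p` (`π(g) dπ(A) π(g)⁻¹ = dπ(Ad(g)A)` position by position).
* §5 `colourChangeAt G a` — the change of letters `y(j, ℓ) = ∑_{ℓ'} (G j)_{ℓ' ℓ} y'(j, ℓ')` by a
  SLOT-DEPENDENT matrix `G : J → M_N(k)` on coefficient functions of words in letters `J × Fin N`:
  slices (`wordSlice_colourChangeAt`: `= wordRepAt (G ∘ u)` on the slice at the slot word `u`),
  antisymmetry (`IsAntisymm.colourChangeAt`) and the evaluation identity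
  `wordEval F y a = wordEval F y' (colourChangeAt G a)` (`wordEval_eq_wordEval_colourChangeAt`).

## References

* [GoodmanWallachGTM255] R. Goodman, N. R. Wallach, *Symmetry, Representations, and Invariants*,
  GTM 255 (2009), §4.1.1 (tensor products of representations of a group and of a Lie algebra:
  `(ρ₁ ⊗ ρ₂)(g) = ρ₁(g) ⊗ ρ₂(g)`, `d(ρ₁ ⊗ ρ₂)(X) = dρ₁(X) ⊗ I + I ⊗ dρ₂(X)`).
  [cite: GoodmanWallachGTM255, §4.1.1]
* [FultonYoungTableaux1997] W. Fulton, *Young Tableaux*, LMS Student Texts 35 (1997), §8.1 (the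
  basis `e_w` of `V^{⊗d}` indexed by words and the action of `GL(V)` on it).
  [cite: FultonYoungTableaux1997, §8.1]
-/

noncomputable section

open scoped BigOperators

namespace Literature.RepresentationTheory.GeneralLinear

open Literature.NumberTheory.DiophantineGeometry

/-! ### §1 The Kronecker product of a family of matrices -/

section TensorMatrix

variable (k : Type*) [CommRing k] {N d : ℕ}

/-- The Kronecker product `g₀ ⊗ ⋯ ⊗ g_{d-1}` of a family of `N × N` matrices, as a matrix indexed by
words: `(w', w) ↦ ∏_p (g p)_{w'(p) w(p)}` (Goodman–Wallach §4.1.1, `(ρ₁ ⊗ ρ₂)(g) = ρ₁(g) ⊗ ρ₂(g)`, in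
the word basis of Fulton §8.1). [cite: GoodmanWallachGTM255, §4.1.1] -/
def tensorMatrixAt (g : Fin d → Matrix (Fin N) (Fin N) k) : Matrix (Word N d) (Word N d) k :=
  Matrix.of fun w' w => ∏ p, g p (w' p) (w p)

/-- Entries of the Kronecker product of a family (unfolding lemma). [cite: GoodmanWallachGTM255, §4.1.1] -/
@[simp]
theorem tensorMatrixAt_apply (g : Fin d → Matrix (Fin N) (Fin N) k) (w' w : Word N d) :
    tensorMatrixAt k g w' w = ∏ p, g p (w' p) (w p) :=
  rfl

/-- On a constant family the Kronecker product is the tree's Kronecker power.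
[cite: GoodmanWallachGTM255, §4.1.1] -/
theorem tensorMatrixAt_const (g : Matrix (Fin N) (Fin N) k) :
    tensorMatrixAt k (fun _ : Fin d => g) = tensorPowerMatrix k N d g := by
  ext w' w
  rw [tensorMatrixAt_apply, tensorPowerMatrix_apply]

/-- The Kronecker product of the identity family is the identity. [cite: GoodmanWallachGTM255, §4.1.1] -/
theorem tensorMatrixAt_one : tensorMatrixAt k (1 : Fin d → Matrix (Fin N) (Fin N) k) = 1 := by
  ext w' w
  rw [tensorMatrixAt_apply, Matrix.one_apply]
  by_cases h : w' = w
  · subst h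
    simp
  · obtain ⟨p, hp⟩ := Function.ne_iff.1 h
    rw [if_neg h]
    exact Finset.prod_eq_zero (Finset.mem_univ p) (by rw [Pi.one_apply, Matrix.one_apply_ne hp])

/-- The Kronecker product is multiplicative in the family (pointwise products):
`(g h)₀ ⊗ ⋯ = (g₀ ⊗ ⋯)(h₀ ⊗ ⋯)`. [cite: GoodmanWallachGTM255, §4.1.1] -/
theorem tensorMatrixAt_mul (g h : Fin d → Matrix (Fin N) (Fin N) k) :
    tensorMatrixAt k (g * h) = tensorMatrixAt k g * tensorMatrixAt k h := by
  ext w' w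
  simp only [tensorMatrixAt_apply, Matrix.mul_apply, Pi.mul_apply]
  rw [Fintype.prod_sum]
  refine Finset.sum_congr rfl fun v _ => ?_
  rw [Finset.prod_mul_distrib]

end TensorMatrix

/-! ### §2 The position-dependent action on the word model -/

section RepAt

variable (k : Type*) [CommRing k] {N d : ℕ}

/-- **The tensor product of a family of matrix actions on the word model**:
`(g · c)(w') = ∑_w (∏_p (g p)_{w'(p) w(p)}) c(w)` — position `p` is moved by `g p`
(Goodman–Wallach §4.1.1 in the coordinates of Fulton §8.1; for a constant invertible family this is
the tree's `wordRep`, `wordRepAt_const`). [cite: GoodmanWallachGTM255, §4.1.1] -/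
def wordRepAt (g : Fin d → Matrix (Fin N) (Fin N) k) : (Word N d → k) →ₗ[k] (Word N d → k) :=
  Matrix.mulVecLin (tensorMatrixAt k g)

/-- The action in coordinates: `(g · c)(w') = ∑_w (∏_p (g p)_{w' p, w p}) c(w)`.
[cite: GoodmanWallachGTM255, §4.1.1] -/
theorem wordRepAt_apply (g : Fin d → Matrix (Fin N) (Fin N) k) (c : Word N d → k) (w' : Word N d) :
    wordRepAt k g c w' = ∑ w, (∏ p, g p (w' p) (w p)) * c w :=
  rfl

/-- The action is multiplicative in the family. [cite: GoodmanWallachGTM255, §4.1.1] -/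
theorem wordRepAt_mul (g h : Fin d → Matrix (Fin N) (Fin N) k) (c : Word N d → k) :
    wordRepAt k (g * h) c = wordRepAt k g (wordRepAt k h c) := by
  change Matrix.mulVecLin (tensorMatrixAt k (g * h)) c =
    Matrix.mulVecLin (tensorMatrixAt k g) (Matrix.mulVecLin (tensorMatrixAt k h) c)
  rw [tensorMatrixAt_mul, Matrix.mulVecLin_mul]
  rfl

/-- The identity family acts trivially. [cite: GoodmanWallachGTM255, §4.1.1] -/
theorem wordRepAt_one (c : Word N d → k) : wordRepAt k (1 : Fin d → Matrix (Fin N) (Fin N) k) c = c := by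
  change Matrix.mulVecLin (tensorMatrixAt k (1 : Fin d → Matrix (Fin N) (Fin N) k)) c = c
  rw [tensorMatrixAt_one, Matrix.mulVecLin_one]
  rfl

/-- On a constant invertible family the position-dependent action is the tree's `wordRep`.
[cite: GoodmanWallachGTM255, §4.1.1] -/
theorem wordRepAt_const [Nontrivial k] (g : GL (Fin N) k) (c : Word N d → k) :
    wordRepAt k (fun _ : Fin d => (g : Matrix (Fin N) (Fin N) k)) c = wordRep k N d g c := by
  funext w'
  rw [wordRepAt_apply, wordRep_apply]

/-- A pointwise left-invertible family acts injectively. [cite: GoodmanWallachGTM255, §4.1.1] -/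
theorem wordRepAt_injective {g g' : Fin d → Matrix (Fin N) (Fin N) k} (h : g' * g = 1) :
    Function.Injective (wordRepAt k g : (Word N d → k) → (Word N d → k)) := by
  intro c c' hc
  have := congrArg (wordRepAt k g') hc
  rwa [← wordRepAt_mul, ← wordRepAt_mul, h, wordRepAt_one, wordRepAt_one] at this

end RepAt

/-! ### §3 The position-dependent differential -/

section DerAt

variable (k : Type*) [CommRing k] {N d : ℕ}

/-- **The differential of the tensor product of a family of matrix actions**:
`(D(A) c)(w) = ∑_p ∑_b (A p)_{w(p) b} c(w[p ↦ b])` — position `p` is moved by `A p`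
(`d(ρ₁ ⊗ ⋯ ⊗ ρ_d)(X) = ∑_p 1 ⊗ ⋯ ⊗ dρ_p(X) ⊗ ⋯ ⊗ 1`, Goodman–Wallach §4.1.1, in coordinates; for a
constant family the tree's `wordDer`, `wordDerAt_const`). [cite: GoodmanWallachGTM255, §4.1.1] -/
def wordDerAt (A : Fin d → Matrix (Fin N) (Fin N) k) : (Word N d → k) →ₗ[k] (Word N d → k) where
  toFun c w := ∑ p, ∑ b, A p (w p) b * c (Function.update w p b)
  map_add' c c' := by
    funext w
    simp only [Pi.add_apply, mul_add, Finset.sum_add_distrib]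
  map_smul' r c := by
    funext w
    simp only [Pi.smul_apply, smul_eq_mul, RingHom.id_apply, Finset.mul_sum]
    exact Finset.sum_congr rfl fun p _ => Finset.sum_congr rfl fun b _ => by ring

/-- Unfolding lemma for `wordDerAt`. [cite: GoodmanWallachGTM255, §4.1.1] -/
theorem wordDerAt_apply (A : Fin d → Matrix (Fin N) (Fin N) k) (c : Word N d → k) (w : Word N d) :
    wordDerAt k A c w = ∑ p, ∑ b, A p (w p) b * c (Function.update w p b) :=
  rfl

/-- On a constant family the position-dependent differential is the tree's `wordDer`.
[cite: GoodmanWallachGTM255, §4.1.1] -/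
theorem wordDerAt_const (A : Matrix (Fin N) (Fin N) k) (c : Word N d → k) :
    wordDerAt k (fun _ : Fin d => A) c = wordDer k A c := by
  funext w
  rw [wordDerAt_apply, wordDer_apply]

/-- `D` is additive in the family. [cite: GoodmanWallachGTM255, §4.1.1] -/
theorem wordDerAt_add (A B : Fin d → Matrix (Fin N) (Fin N) k) (c : Word N d → k) :
    wordDerAt k (A + B) c = wordDerAt k A c + wordDerAt k B c := by
  funext w
  simp only [wordDerAt_apply, Pi.add_apply, Matrix.add_apply, add_mul, Finset.sum_add_distrib]

/-- `D` respects differences in the family. [cite: GoodmanWallachGTM255, §4.1.1] -/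
theorem wordDerAt_sub (A B : Fin d → Matrix (Fin N) (Fin N) k) (c : Word N d → k) :
    wordDerAt k (A - B) c = wordDerAt k A c - wordDerAt k B c := by
  funext w
  simp only [wordDerAt_apply, Pi.sub_apply, Matrix.sub_apply, sub_mul, Finset.sum_sub_distrib]

/-- `D` is homogeneous in the family. [cite: GoodmanWallachGTM255, §4.1.1] -/
theorem wordDerAt_smul (r : k) (A : Fin d → Matrix (Fin N) (Fin N) k) (c : Word N d → k) :
    wordDerAt k (r • A) c = r • wordDerAt k A c := by
  funext w
  simp only [wordDerAt_apply, Pi.smul_apply, Matrix.smul_apply, smul_eq_mul, Finset.mul_sum,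
    mul_assoc]

/-- `D` of the zero family vanishes. [cite: GoodmanWallachGTM255, §4.1.1] -/
theorem wordDerAt_zero (c : Word N d → k) :
    wordDerAt k (0 : Fin d → Matrix (Fin N) (Fin N) k) c = 0 := by
  funext w
  simp [wordDerAt_apply]

/-- The family as a function is what matters: `D` as a map on families is `k`-linear, so in
particular `D(∑ᵢ Aᵢ) = ∑ᵢ D(Aᵢ)`. [cite: GoodmanWallachGTM255, §4.1.1] -/
theorem wordDerAt_sum {ι : Type*} (s : Finset ι) (A : ι → Fin d → Matrix (Fin N) (Fin N) k)
    (c : Word N d → k) : wordDerAt k (∑ i ∈ s, A i) c = ∑ i ∈ s, wordDerAt k (A i) c := by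
  classical
  induction s using Finset.induction_on with
  | empty => simp [wordDerAt_zero]
  | insert i s hi ih => rw [Finset.sum_insert hi, Finset.sum_insert hi, wordDerAt_add, ih]

/-- **A family supported at one position moves that position only**:
`(D(0,…,A,…,0) c)(w) = ∑_b A_{w(p) b} c(w[p ↦ b])`. [cite: GoodmanWallachGTM255, §4.1.1] -/
theorem wordDerAt_single_apply (p : Fin d) (A : Matrix (Fin N) (Fin N) k) (c : Word N d → k)
    (w : Word N d) :
    wordDerAt k (Pi.single p A) c w = ∑ b, A (w p) b * c (Function.update w p b) := by
  classical
  rw [wordDerAt_apply, Finset.sum_eq_single p]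
  · rw [Pi.single_eq_same]
  · intro q _ hq
    simp [Pi.single_eq_of_ne hq]
  · intro h
    exact absurd (Finset.mem_univ p) h

/-- `D` is the sum over the positions of its one-position pieces.
[cite: GoodmanWallachGTM255, §4.1.1] -/
theorem wordDerAt_eq_sum_single (A : Fin d → Matrix (Fin N) (Fin N) k) (c : Word N d → k) :
    wordDerAt k A c = ∑ p, wordDerAt k (Pi.single p (A p)) c := by
  classical
  rw [← wordDerAt_sum, Finset.univ_sum_single A]

/-- `D` of a family of diagonal matrices multiplies by the sum of the diagonal weights of the
letters: `(D(diag δ) c)(w) = (∑_p (δ p)_{w p}) c(w)`. [cite: GoodmanWallachGTM255, §4.1.1] -/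
theorem wordDerAt_diagonal_apply (δ : Fin d → Fin N → k) (c : Word N d → k) (w : Word N d) :
    wordDerAt k (fun p => Matrix.diagonal (δ p)) c w = (∑ p, δ p (w p)) * c w := by
  classical
  rw [wordDerAt_apply, Finset.sum_mul]
  refine Finset.sum_congr rfl fun p _ => ?_
  rw [Finset.sum_eq_single (w p)]
  · rw [Matrix.diagonal_apply_eq, Function.update_eq_self]
  · intro b _ hb
    rw [Matrix.diagonal_apply_ne _ (Ne.symm hb), zero_mul]
  · intro h
    exact absurd (Finset.mem_univ _) h

/-- `D` commutes with extension of scalars: for a ring map `f`, `D(f(A))(f ∘ c) = f ∘ D(A) c`.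
[cite: GoodmanWallachGTM255, §4.1.1] -/
theorem wordDerAt_map {k' : Type*} [CommRing k'] (f : k →+* k') (A : Fin d → Matrix (Fin N) (Fin N) k)
    (c : Word N d → k) (w : Word N d) :
    wordDerAt k' (fun p => (A p).map f) (fun v => f (c v)) w = f (wordDerAt k A c w) := by
  simp only [wordDerAt_apply, map_sum, map_mul, Matrix.map_apply]

/-- The composite of two position-dependent differentials: `D(A) D(B) = D(p ↦ A p B p) + (cross terms)`,
the cross terms — one position changed by `A`, a different one by `B` — being
`∑_{p ≠ q} ∑_{b,e} (A p)_{w(p) b} (B q)_{w(q) e} c(w[p ↦ b][q ↦ e])`. [cite: GoodmanWallachGTM255, §4.1.1] -/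
private theorem wordDerAt_wordDerAt_apply (A B : Fin d → Matrix (Fin N) (Fin N) k)
    (c : Word N d → k) (w : Word N d) :
    wordDerAt k A (wordDerAt k B c) w = wordDerAt k (A * B) c w +
      ∑ p, ∑ q, if q = p then 0 else
        ∑ b, ∑ e, A p (w p) b * (B q (w q) e * c (Function.update (Function.update w p b) q e)) := by
  classical
  rw [wordDerAt_apply, wordDerAt_apply, ← Finset.sum_add_distrib]
  refine Finset.sum_congr rfl fun p _ => ?_
  have key : ∀ b, wordDerAt k B c (Function.update w p b) =
      (∑ e, B p b e * c (Function.update w p e)) +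
        ∑ q, if q = p then 0 else
          ∑ e, B q (w q) e * c (Function.update (Function.update w p b) q e) := by
    intro b
    rw [wordDerAt_apply]
    have h1 : ∀ q, (∑ e, B q (Function.update w p b q) e *
        c (Function.update (Function.update w p b) q e)) =
        (if q = p then ∑ e, B p b e * c (Function.update w p e) else 0) +
          if q = p then 0 else
            ∑ e, B q (w q) e * c (Function.update (Function.update w p b) q e) := by
      intro q
      by_cases hq : q = p
      · subst hq
        rw [if_pos rfl, if_pos rfl, add_zero, Function.update_self]
        exact Finset.sum_congr rfl fun e _ => by rw [Function.update_idem]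
      · rw [if_neg hq, if_neg hq, zero_add, Function.update_of_ne hq]
    simp_rw [h1]
    rw [Finset.sum_add_distrib, Finset.sum_ite_eq', if_pos (Finset.mem_univ _)]
  simp_rw [key, mul_add, Finset.sum_add_distrib]
  congr 1
  · simp only [Pi.mul_apply, Matrix.mul_apply, Finset.sum_mul, Finset.mul_sum]
    rw [Finset.sum_comm]
    exact Finset.sum_congr rfl fun e _ => Finset.sum_congr rfl fun b _ => by ring
  · simp only [Finset.mul_sum, mul_ite, mul_zero]
    rw [Finset.sum_comm]
    refine Finset.sum_congr rfl fun q _ => ?_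
    rw [Finset.sum_ite_irrel, Finset.sum_const_zero]

/-- The cross terms are symmetric in `(A, B)`. [folklore] -/
private theorem crossAt_symm (A B : Fin d → Matrix (Fin N) (Fin N) k) (c : Word N d → k) (w : Word N d) :
    (∑ p, ∑ q, if q = p then (0 : k) else
        ∑ b, ∑ e, A p (w p) b * (B q (w q) e * c (Function.update (Function.update w p b) q e))) =
      ∑ p, ∑ q, if q = p then (0 : k) else
        ∑ b, ∑ e, B p (w p) b * (A q (w q) e * c (Function.update (Function.update w p b) q e)) := by
  rw [Finset.sum_comm]
  refine Finset.sum_congr rfl fun p _ => Finset.sum_congr rfl fun q _ => ?_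
  by_cases hq : q = p
  · subst hq
    simp
  · rw [if_neg hq, if_neg (Ne.symm hq), Finset.sum_comm]
    refine Finset.sum_congr rfl fun b _ => Finset.sum_congr rfl fun e _ => ?_
    rw [Function.update_comm hq]
    ring

/-- **The position-dependent differential is a Lie algebra representation of the product algebra
`𝔤𝔩_N × ⋯ × 𝔤𝔩_N`**: `[D(A), D(B)] = D(p ↦ [A p, B p])` (Goodman–Wallach §4.1.1: the differential
of a tensor product of representations is a representation). [cite: GoodmanWallachGTM255, §4.1.1] -/
theorem wordDerAt_commutator (A B : Fin d → Matrix (Fin N) (Fin N) k) (c : Word N d → k) :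
    wordDerAt k A (wordDerAt k B c) - wordDerAt k B (wordDerAt k A c) =
      wordDerAt k (A * B - B * A) c := by
  funext w
  rw [Pi.sub_apply, wordDerAt_wordDerAt_apply, wordDerAt_wordDerAt_apply, crossAt_symm, wordDerAt_sub,
    Pi.sub_apply]
  ring

/-- The annihilator of a tensor in the product algebra is closed under pointwise commutators (the
input `hlie` of `Sl2ProductRationalSubalgebras.sl2_product_annihilator`).
[cite: GoodmanWallachGTM255, §4.1.1] -/
theorem wordDerAt_commutator_eq_zero {A B : Fin d → Matrix (Fin N) (Fin N) k} {c : Word N d → k}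
    (hA : wordDerAt k A c = 0) (hB : wordDerAt k B c = 0) : wordDerAt k (A * B - B * A) c = 0 := by
  rw [← wordDerAt_commutator, hA, hB, map_zero, map_zero, sub_zero]

end DerAt

/-! ### §4 The adjoint equivariance, position by position -/

section AdjointAt

variable (k : Type*) [CommRing k] {N d : ℕ}

/-- A product over the positions, with one position singled out (family version). [folklore] -/
private theorem prod_update_eq_at (g : Fin d → Matrix (Fin N) (Fin N) k) (ε' ε : Word N d) (q : Fin d)
    (b : Fin N) :
    (∏ p, g p ((Function.update ε' q b) p) (ε p)) =
      g q b (ε q) * ∏ p ∈ Finset.univ.erase q, g p (ε' p) (ε p) := by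
  rw [← Finset.mul_prod_erase Finset.univ _ (Finset.mem_univ q), Function.update_self]
  congr 1
  exact Finset.prod_congr rfl fun p hp => by rw [Function.update_of_ne (Finset.ne_of_mem_erase hp)]

/-- The same with the update in the second word (family version). [folklore] -/
private theorem prod_update_eq_at' (g : Fin d → Matrix (Fin N) (Fin N) k) (ε' v : Word N d) (q : Fin d)
    (b : Fin N) :
    (∏ p, g p (ε' p) ((Function.update v q b) p)) =
      g q (ε' q) b * ∏ p ∈ Finset.univ.erase q, g p (ε' p) (v p) := by
  rw [← Finset.mul_prod_erase Finset.univ _ (Finset.mem_univ q), Function.update_self]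
  congr 1
  exact Finset.prod_congr rfl fun p hp => by rw [Function.update_of_ne (Finset.ne_of_mem_erase hp)]

/-- The re-indexing `(ε, b) ↦ (ε[q ↦ b], ε q)` of `Word N d × Fin N` is an involution. [folklore] -/
private theorem involutive_update_at (q : Fin d) :
    Function.Involutive fun x : Word N d × Fin N => (Function.update x.1 q x.2, x.1 q) := by
  rintro ⟨ε, b⟩
  simp only [Function.update_self, Function.update_idem, Function.update_eq_self]

/-- **The adjoint action, position by position: `g · D(A) = D(B) · g` whenever `B p · g p = g p · A p`
for every position `p`** (`π(g) dπ(A) π(g)⁻¹ = dπ(Ad(g)A)` for the tensor product of a family of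
actions). Both sides applied to `c` at a word `ε'` equal
`∑_q ∑_v (g q · A q)_{ε'(q) v(q)} (∏_{p ≠ q} (g p)_{ε'(p) v(p)}) c(v)`. [cite: GoodmanWallachGTM255, §4.1.1] -/
theorem wordRepAt_wordDerAt_of_mul_eq (g : Fin d → Matrix (Fin N) (Fin N) k)
    {A B : Fin d → Matrix (Fin N) (Fin N) k} (h : ∀ p, B p * g p = g p * A p) (c : Word N d → k) :
    wordRepAt k g (wordDerAt k A c) = wordDerAt k B (wordRepAt k g c) := by
  classical
  funext ε'
  set R : Fin d → Word N d → k := fun q v => (∏ p ∈ Finset.univ.erase q, g p (ε' p) (v p)) * c v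
    with hR
  have hL : wordRepAt k g (wordDerAt k A c) ε' = ∑ q, ∑ v : Word N d, (g q * A q) (ε' q) (v q) * R q v := by
    rw [wordRepAt_apply]
    simp_rw [wordDerAt_apply, Finset.mul_sum]
    rw [Finset.sum_comm]
    refine Finset.sum_congr rfl fun q _ => ?_
    rw [← Fintype.sum_prod_type',
      ← Equiv.sum_comp (Function.Involutive.toPerm _ (involutive_update_at (N := N) q))]
    simp only [Function.Involutive.coe_toPerm, Function.update_self, Function.update_idem,
      Function.update_eq_self]
    rw [Fintype.sum_prod_type]
    refine Finset.sum_congr rfl fun v _ => ?_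
    rw [hR, Matrix.mul_apply, Finset.sum_mul]
    refine Finset.sum_congr rfl fun b _ => ?_
    dsimp only
    rw [prod_update_eq_at' k g ε' v q b]
    ring
  have hRt : wordDerAt k B (wordRepAt k g c) ε' = ∑ q, ∑ v : Word N d, (B q * g q) (ε' q) (v q) * R q v := by
    rw [wordDerAt_apply]
    refine Finset.sum_congr rfl fun q _ => ?_
    simp_rw [wordRepAt_apply, Finset.mul_sum]
    rw [Finset.sum_comm]
    refine Finset.sum_congr rfl fun v _ => ?_
    rw [hR]
    simp only [Matrix.mul_apply, Finset.sum_mul]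
    refine Finset.sum_congr rfl fun b _ => ?_
    rw [prod_update_eq_at k g ε' v q b]
    ring
  rw [hL, hRt]
  exact Finset.sum_congr rfl fun q _ => by rw [h q]

/-- Corollary: the transport of an annihilator. If `D(A) c = 0` and `B p · g p = g p · A p` for all
`p`, then `D(B) (g · c) = 0`. [cite: GoodmanWallachGTM255, §4.1.1] -/
theorem wordDerAt_wordRepAt_eq_zero_of_mul_eq (g : Fin d → Matrix (Fin N) (Fin N) k)
    {A B : Fin d → Matrix (Fin N) (Fin N) k} (h : ∀ p, B p * g p = g p * A p)
    {c : Word N d → k} (hc : wordDerAt k A c = 0) : wordDerAt k B (wordRepAt k g c) = 0 := by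
  rw [← wordRepAt_wordDerAt_of_mul_eq k g h, hc, map_zero]

end AdjointAt

/-! ### §5 The slot-dependent change of letters on coefficient functions -/

section ColourChangeAt

variable {K : Type*} [CommRing K] {H M : Type*} [AddCommGroup H] [Module K H] [AddCommGroup M]
  [Module K M] {J : Type*} {N d : ℕ}

/-- **The slot-dependent colour base change of coefficient functions** along a family of matrices
`G : J → M_N(K)` (one matrix per slot): `(colourChangeAt G a)(u, ε') = ∑_ε (∏_p (G (u p))_{ε'(p) ε(p)}) a(u, ε)`
— slice by slice, the Kronecker product of the family `G ∘ u` (`wordSlice_colourChangeAt`). For a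
constant family this is the tree's `colourChange`. [cite: FultonYoungTableaux1997, §8.1] -/
def colourChangeAt (G : J → Matrix (Fin N) (Fin N) K) (a : (Fin d → J × Fin N) → K) :
    (Fin d → J × Fin N) → K :=
  fun w => ∑ ε : Word N d, (∏ p, G (w p).1 (w p).2 (ε p)) * a fun p => ((w p).1, ε p)

/-- On a constant family the slot-dependent base change is the tree's `colourChange`.
[cite: FultonYoungTableaux1997, §8.1] -/
theorem colourChangeAt_const (g : Matrix (Fin N) (Fin N) K) (a : (Fin d → J × Fin N) → K) :
    colourChangeAt (fun _ : J => g) a = colourChange g a :=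
  rfl

/-- The slices of the slot-dependent base change are the images of the slices under the Kronecker
product of the family `G ∘ u`. [cite: FultonYoungTableaux1997, §8.1] -/
theorem wordSlice_colourChangeAt (G : J → Matrix (Fin N) (Fin N) K) (a : (Fin d → J × Fin N) → K)
    (u : Fin d → J) :
    wordSlice (colourChangeAt G a) u = wordRepAt K (fun p => G (u p)) (wordSlice a u) := by
  funext ε'
  rw [wordRepAt_apply]
  rfl

/-- The slot-dependent base change preserves antisymmetry (it commutes with the simultaneous
permutation of the positions of slot words and colour words). [cite: FultonYoungTableaux1997, §8.1] -/
theorem IsAntisymm.colourChangeAt {a : (Fin d → J × Fin N) → K} (ha : IsAntisymm a)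
    (G : J → Matrix (Fin N) (Fin N) K) : IsAntisymm (colourChangeAt G a) := by
  intro σ w
  change (∑ ε : Word N d, (∏ p, G (w (σ p)).1 (w (σ p)).2 (ε p)) * a fun p => ((w (σ p)).1, ε p)) =
    _ * ∑ ε : Word N d, (∏ p, G (w p).1 (w p).2 (ε p)) * a fun p => ((w p).1, ε p)
  rw [Finset.mul_sum, ← Equiv.sum_comp (wordPermEquiv (Fin N) σ)]
  refine Finset.sum_congr rfl fun ε _ => ?_
  rw [wordPermEquiv_apply]
  have h1 : (∏ p, G (w (σ p)).1 (w (σ p)).2 ((ε ∘ ⇑σ) p)) = ∏ p, G (w p).1 (w p).2 (ε p) :=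
    Equiv.prod_comp σ (fun p => G (w p).1 (w p).2 (ε p))
  have h2 : (a fun p => ((w (σ p)).1, (ε ∘ ⇑σ) p)) =
      ((Equiv.Perm.sign σ : ℤ) : K) * a fun p => ((w p).1, ε p) :=
    ha σ fun p => ((w p).1, ε p)
  rw [h1, h2]
  ring

/-- **Slot-dependent letter base change.** If the letters `y` are obtained from letters `y'` by a
colour matrix `G j` on slot `j`, `y(j, ℓ) = ∑_{ℓ'} (G j)_{ℓ' ℓ} y'(j, ℓ')`, then the evaluation of `a`
on `y` is the evaluation of `colourChangeAt G a` on `y'` (multilinear expansion of every monomial).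
[cite: FultonYoungTableaux1997, §8.1] [cite: Greub1978Multilinear, §5.7 (5.12)–(5.13)] -/
theorem wordEval_eq_wordEval_colourChangeAt [Fintype J] (F : H [⋀^Fin d]→ₗ[K] M)
    {y y' : J × Fin N → H} (G : J → Matrix (Fin N) (Fin N) K)
    (hy : ∀ j ℓ, y (j, ℓ) = ∑ ℓ', G j ℓ' ℓ • y' (j, ℓ')) (a : (Fin d → J × Fin N) → K) :
    wordEval F y a = wordEval F y' (colourChangeAt G a) := by
  rw [wordEval_eq_sum_wordSlice, wordEval_eq_sum_wordSlice]
  refine Finset.sum_congr rfl fun u _ => ?_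
  have hF : ∀ ε : Word N d, F (fun p => y (u p, ε p)) =
      ∑ ε' : Word N d, (∏ p, G (u p) (ε' p) (ε p)) • F (fun p => y' (u p, ε' p)) := by
    intro ε
    have h1 : (fun p => y (u p, ε p)) = fun p => ∑ ℓ', G (u p) ℓ' (ε p) • y' (u p, ℓ') :=
      funext fun p => hy _ _
    rw [h1]
    have h2 := F.toMultilinearMap.map_sum fun p ℓ' => G (u p) ℓ' (ε p) • y' (u p, ℓ')
    simp only [AlternatingMap.coe_multilinearMap] at h2
    rw [h2]
    refine Finset.sum_congr rfl fun ε' _ => ?_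
    have h3 := F.toMultilinearMap.map_smul_univ (fun p => G (u p) (ε' p) (ε p)) fun p => y' (u p, ε' p)
    simp only [AlternatingMap.coe_multilinearMap] at h3
    exact h3
  have hslice : ∀ ε' : Word N d, wordSlice (colourChangeAt G a) u ε' =
      ∑ ε : Word N d, (∏ p, G (u p) (ε' p) (ε p)) * wordSlice a u ε := fun ε' => rfl
  simp_rw [hF, Finset.smul_sum, smul_smul, hslice, Finset.sum_smul]
  rw [Finset.sum_comm]
  refine Finset.sum_congr rfl fun ε' _ => Finset.sum_congr rfl fun ε _ => ?_
  rw [mul_comm]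

end ColourChangeAt

end Literature.RepresentationTheory.GeneralLinear
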